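import Mathlib
import Summits.Ventures.PercRepro2.Defs
import Summits.Ventures.PercRepro2.Graph
import Summits.Ventures.PercRepro2.OneColourSwitch
import Summits.Ventures.PercRepro2.RegionHubSign
import Summits.Ventures.PercRepro2.SideSwitch
import Summits.Ventures.PercRepro2.TermSwitchDefs
import Summits.Ventures.PercRepro2.M9NoPocketDefs
import Summits.Ventures.PercRepro2.M9PsiOneDefs
import Summits.Ventures.PercRepro2.M9PsiOneWorlds
import Summits.Ventures.PercRepro2.M9PsiOneLink
import Summits.Ventures.PercRepro2.M9PsiOneInj
import Summits.Ventures.PercRepro2.M9PsiTwoDefs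
import Summits.Ventures.PercRepro2.M9PsiTwoWorlds
import Summits.Ventures.PercRepro2.M9PsiTwoNoLink
import Summits.Ventures.PercRepro2.M9PsiTwoLink
import Summits.Ventures.PercRepro2.M9PsiTwoSigma
import Summits.Ventures.PercRepro2.M9PsiTwoDirty
import Summits.Ventures.PercRepro2.M9PsiTwoUnrooted
import Summits.Ventures.PercRepro2.M9PsiTwoRooted

/-!
# Rootedness in the image of `Ψ₂` (blind cell PercRepro2, p3 g34, 2026-08-29;
`proofs/P3-REST2.md` §1, claim (iv), third step — the objects of the pure case)

`rootedY t x`: `x` is `Y`-rooted at `t` inside its image block; `deadRoot ω'`: the root of the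
dead ends of `ω'` (`r` if some `W`-neighbour of `d` in the `Y`-core is `Y`-rooted at `r` inside
its block, else `s`); `oppJoined`: a block with an open edge to `d` and a vertex rooted at the
root opposite to the dead ends; `PureY`: no `Y`-linking vertex; `RsetP`: the full
reconstruction set.  The TRANSFERS: the image block of a flipped vertex lies in its old block
(`blockIn_psiTwo_subset_blockIn`); a vertex `Y`-rooted in the image is `W`-rooted in `ω`
(`rootedW_of_rootedY_psiTwo`); a direct flipped vertex is `Y`-rooted in the image at some
terminal (`exists_rootedY_psiTwo`), and in the pure case at the terminal it is `W`-rooted at,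
not at the other (`rootedY_psiTwo_of_pure`).  Own work; std axioms.
-/

namespace Summit.Ventures.PercRepro2

namespace NoPocket

open Finset Classical RegionHub OneColourSwitch SideSwitch TermSwitch

variable {V : Type*} {E : Type*}

section Defs

variable (ends : E → Sym2 V) (r s d : V) (ω' : Config E)

/-- A `Y`-core vertex of `ω'` is `Y`-ROOTED at `t` inside its block (in `ω'`). -/
def rootedY (t x : V) : Prop :=
  x ∈ Kcore ends r s d ω' ∧
    Conn ends (restrictTo ends ω' (blockIn ends (Kcore ends r s d ω') x ∪ {r, s})) t x

/-- The root of the dead ends of `ω'`: `r` if some `W`-neighbour of `d` in the `Y`-core of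
`ω'` is `Y`-rooted at `r` inside its block, else `s`. -/
noncomputable def deadRoot : V :=
  if ∃ x e, ends e = s(x, d) ∧ ω' e = false ∧ rootedY ends r s d ω' r x then r else s

/-- The root opposite to `deadRoot`. -/
noncomputable def oppDeadRoot : V := if deadRoot ends r s d ω' = r then s else r

/-- A `Y`-core vertex of `ω'` is OPP-JOINED if its block has an open edge to `d` and a vertex
`Y`-rooted at the root opposite to the dead ends. -/
def oppJoined (x : V) : Prop :=
  ∃ y ∈ blockIn ends (Kcore ends r s d ω') x, (∃ e, ends e = s(y, d) ∧ ω' e = true) ∧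
    rootedY ends r s d ω' (oppDeadRoot ends r s d ω') y

/-- The image is PURE if it has no `Y`-linking vertex. -/
def PureY : Prop := ∀ x, ¬ linkingY ends r s d ω' x

/-- The full reconstruction set: `Rset`, and — when the image is pure — the opp-joined
vertices. -/
def RsetP : Set V :=
  Rset ends r s d ω' ∪ {x | x ∈ Kcore ends r s d ω' ∧ PureY ends r s d ω' ∧ oppJoined ends r s d ω' x}

end Defs

section Pure

variable {ends : E → Sym2 V} {p q r s d : V} {ω : Config E}

variable (h : IsEX ends p q r s d ω)
include h

/-- The block (in `Ψ₂ ω`) of a direct flipped vertex lies in its old block. -/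
lemma blockIn_psiTwo_subset_blockIn {x : V} (hx : x ∈ flipSetW ends r s d ω) :
    blockIn ends (Kcore ends r s d (psiTwo ends r s d ω)) x ⊆
      blockIn ends (Mcore ends r s d ω) x := by
  intro y hy
  have key : y ∈ {z | z ∈ blockIn ends (Mcore ends r s d ω) x} := by
    refine mem_of_conn_of_closed (ends := ends)
      (ω := allIn ends (Kcore ends r s d (psiTwo ends r s d ω))) ?_ (mem_blockIn_self _ _) hy
    intro a ha b hab
    obtain ⟨hne, e, he, hends⟩ := openGraph_adj.1 hab
    unfold allIn at he
    by_cases hw : e ∈ within ends (Kcore ends r s d (psiTwo ends r s d ω))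
    · obtain ⟨u, hu, v, hv, huv⟩ := hw
      have hbK : b ∈ Kcore ends r s d (psiTwo ends r s d ω) := by
        rw [hends, Sym2.eq_iff] at huv
        rcases huv with ⟨_, h2⟩ | ⟨_, h2⟩
        · rw [h2]; exact hv
        · rw [h2]; exact hu
      have haM : a ∈ Mcore ends r s d ω := mem_Mcore_of_mem_blockIn (flipSetW_subset_Mcore hx) ha
      rcases Kcore_psiTwo_cases h hbK with hb | ⟨hbF, _⟩
      · exact (no_edge_core_core h hb haM (ends_swap hends)).elim
      · exact conn_trans ha (conn_allIn_of_edge haM (flipSetW_subset_Mcore hbF) hends)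
    · rw [if_neg hw] at he; exact absurd he Bool.false_ne_true
  exact key

/-- **Back-transfer**: a flipped vertex `Y`-rooted at `t` inside its image block is
`W`-rooted at `t` in `ω` (no edge `r–s`). -/
lemma rootedW_of_rootedY_psiTwo (hrs : ∀ e, ends e ≠ s(r, s)) {t x : V}
    (hx : x ∈ flipSetW ends r s d ω)
    (hr : rootedY ends r s d (psiTwo ends r s d ω) t x) : rootedW ends r s d ω t x := by
  refine ⟨flipSetW_subset_Mcore hx, ?_⟩
  have h1 : Conn ends (restrictTo ends (psiTwo ends r s d ω)
      (blockIn ends (Mcore ends r s d ω) x ∪ {r, s})) t x :=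
    conn_mono (restrictTo_mono (Set.union_subset_union_left _
      (blockIn_psiTwo_subset_blockIn h hx))) hr.2
  exact conn_restrictTo_transfer (fun e a b hab ha hb hends =>
    (psiTwo_eq_not_on_block h hrs hx e a b hab ha hb hends).symm) h1

/-- **Forward transfer**: a direct flipped vertex is `Y`-rooted at some terminal inside its
image block — every old-block vertex reached from a terminal by closed edges of `ω` inside the
old block is direct and `Y`-rooted in the image inside its own image block (no edge `r–s`). -/
lemma exists_rootedY_psiTwo (hrs : ∀ e, ends e ≠ s(r, s)) {x : V}
    (hx : x ∈ flipSetW ends r s d ω) (hd : directW ends r s d ω x) :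
    rootedY ends r s d (psiTwo ends r s d ω) r x ∨
      rootedY ends r s d (psiTwo ends r s d ω) s x := by
  have hxM := flipSetW_subset_Mcore hx
  let B := blockIn ends (Mcore ends r s d ω) x
  let T : Set V := {v | v = r ∨ v = s ∨ (v ∈ B ∧ directW ends r s d ω v ∧
    (rootedY ends r s d (psiTwo ends r s d ω) r v ∨
      rootedY ends r s d (psiTwo ends r s d ω) s v))}
  have closed : ∀ z ∈ T, ∀ y,
      (openGraph ends (restrictTo ends (OneColourSwitch.compl ω) (B ∪ {r, s}))).Adj z y → y ∈ T := by
    intro z hz y hzy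
    obtain ⟨hne, e, he, hends⟩ := openGraph_adj.1 hzy
    unfold restrictTo at he
    by_cases hw : e ∈ within ends (B ∪ {r, s})
    · rw [if_pos hw] at he
      have hω : ω e = false := by simpa [OneColourSwitch.compl] using he
      obtain ⟨u, hu, v, hv, huv⟩ := hw
      have hzy' : z ∈ B ∪ {r, s} ∧ y ∈ B ∪ {r, s} := by
        rw [hends, Sym2.eq_iff] at huv
        rcases huv with ⟨h1, h2⟩ | ⟨h1, h2⟩
        · rw [h1, h2]; exact ⟨hu, hv⟩
        · rw [h1, h2]; exact ⟨hv, hu⟩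
      rcases hzy'.2 with hyB | hyT
      · have hyM : y ∈ Mcore ends r s d ω := mem_Mcore_of_mem_blockIn hxM hyB
        have hyF : y ∈ flipSetW ends r s d ω := blockIn_subset_flipSetW hx hyB
        have he' : psiTwo ends r s d ω e = true := by
          rw [← psiTwo_eq_not_on_block h hrs hx e z y hne hzy'.1 hzy'.2 hends]
          simp [OneColourSwitch.compl, hω]
        rcases hz with hz | hz | ⟨hzB, hzD, hzR⟩
        · -- from `r`: `y` is direct and `Y`-rooted at `r` through the edge itself
          have hyD : directW ends r s d ω y := directW_of_term_edge (Or.inl hz) hyM (hz ▸ hends) hω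
          have hyK := mem_Kcore_psiTwo_of_directW h hrs hyF hyD
          refine Or.inr (Or.inr ⟨hyB, hyD, Or.inl ⟨hyK, conn_of_openAdj ⟨e, ?_, hz ▸ hends⟩⟩⟩)
          rw [restrictTo_eq (S := blockIn ends (Kcore ends r s d (psiTwo ends r s d ω)) y ∪ {r, s})
            (by simp) (Or.inl (mem_blockIn_self _ _)) (hz ▸ hends)]
          exact he'
        · have hyD : directW ends r s d ω y := directW_of_term_edge (Or.inr hz) hyM (hz ▸ hends) hω
          have hyK := mem_Kcore_psiTwo_of_directW h hrs hyF hyD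
          refine Or.inr (Or.inr ⟨hyB, hyD, Or.inr ⟨hyK, conn_of_openAdj ⟨e, ?_, hz ▸ hends⟩⟩⟩)
          rw [restrictTo_eq (S := blockIn ends (Kcore ends r s d (psiTwo ends r s d ω)) y ∪ {r, s})
            (by simp) (Or.inl (mem_blockIn_self _ _)) (hz ▸ hends)]
          exact he'
        · -- from a direct rooted vertex: `y` is direct, in the same image block, rooted through `z`
          have hyD : directW ends r s d ω y := directW_of_edge hzD hyM hends hω
          have hzK := mem_Kcore_psiTwo_of_directW h hrs (blockIn_subset_flipSetW hx hzB) hzD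
          have hyK := mem_Kcore_psiTwo_of_directW h hrs hyF hyD
          have hblk : blockIn ends (Kcore ends r s d (psiTwo ends r s d ω)) z =
              blockIn ends (Kcore ends r s d (psiTwo ends r s d ω)) y :=
            blockIn_eq_of_conn (conn_allIn_of_edge hzK hyK hends)
          have hstep : Conn ends (restrictTo ends (psiTwo ends r s d ω)
              (blockIn ends (Kcore ends r s d (psiTwo ends r s d ω)) z ∪ {r, s})) z y := by
            refine conn_of_openAdj ⟨e, ?_, hends⟩
            rw [restrictTo_eq (S := blockIn ends (Kcore ends r s d (psiTwo ends r s d ω)) z ∪ {r, s})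
              (Or.inl (mem_blockIn_self _ _)) (Or.inl (hblk ▸ mem_blockIn_self _ _)) hends]
            exact he'
          refine Or.inr (Or.inr ⟨hyB, hyD, ?_⟩)
          rcases hzR with hzR | hzR
          · exact Or.inl ⟨hyK, by rw [← hblk]; exact conn_trans hzR.2 hstep⟩
          · exact Or.inr ⟨hyK, by rw [← hblk]; exact conn_trans hzR.2 hstep⟩
      · simp only [Set.mem_insert_iff, Set.mem_singleton_iff] at hyT
        rcases hyT with rfl | rfl
        · exact Or.inl rfl
        · exact Or.inr (Or.inl rfl)
    · rw [if_neg hw] at he; exact absurd he Bool.false_ne_true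
  have key : x ∈ T := by
    rcases hd with hd | hd
    · exact mem_of_conn_of_closed closed (Or.inl rfl) hd.2
    · exact mem_of_conn_of_closed closed (Or.inr (Or.inl rfl)) hd.2
  rcases key with hk | hk | ⟨_, _, hk⟩
  · exact (term_not_mem_Mcore (Or.inl rfl) (hk ▸ hxM)).elim
  · exact (term_not_mem_Mcore (Or.inr rfl) (hk ▸ hxM)).elim
  · exact hk

/-- In the pure case a direct flipped vertex `W`-rooted at `t` is `Y`-rooted at `t` in the
image, and not at the other terminal (no edge `r–s`). -/
lemma rootedY_psiTwo_of_pure (hrs : ∀ e, ends e ≠ s(r, s)) (hp : PureW ends r s d ω) {t t' x : V}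
    (ht : t = r ∧ t' = s ∨ t = s ∧ t' = r) (hx : x ∈ flipSetW ends r s d ω)
    (hr : rootedW ends r s d ω t x) :
    rootedY ends r s d (psiTwo ends r s d ω) t x ∧
      ¬ rootedY ends r s d (psiTwo ends r s d ω) t' x := by
  have hd : directW ends r s d ω x := by
    rcases ht with ⟨rfl, _⟩ | ⟨rfl, _⟩
    · exact Or.inl hr
    · exact Or.inr hr
  have hnot : ¬ rootedY ends r s d (psiTwo ends r s d ω) t' x := by
    intro hr'
    have hr'' := rootedW_of_rootedY_psiTwo h hrs hx hr'
    rcases ht with ⟨rfl, rfl⟩ | ⟨rfl, rfl⟩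
    · exact hp x (linkingW_of_rootedW_both hr hr'')
    · exact hp x (linkingW_of_rootedW_both hr'' hr)
  refine ⟨?_, hnot⟩
  rcases exists_rootedY_psiTwo h hrs hx hd with hY | hY
  · rcases ht with ⟨rfl, _⟩ | ⟨_, rfl⟩
    · exact hY
    · exact (hnot hY).elim
  · rcases ht with ⟨_, rfl⟩ | ⟨rfl, _⟩
    · exact (hnot hY).elim
    · exact hY

end Pure

end NoPocket

end Summit.Ventures.PercRepro2
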